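import Mathlib
import HarnessLib
import Literature.Analysis.PDE.DivFormLiouville
import Summits.NavierStokesRegularity.NavierStokesRegularity.Theorems.PoloidalWindowDoorPoloidalWindowRigidityDivFormCaccioppoli
import Summits.NavierStokesRegularity.NavierStokesRegularity.Theorems.PoloidalWindowDoorPoloidalWindowRigidityDivFormDescent
import Summits.NavierStokesRegularity.NavierStokesRegularity.Theorems.PoloidalWindowDoorPoloidalWindowRigidityDivFormLiouvilleHigh

/-!
# Route `PoloidalWindowDoor`, crux K2 (stmt-NavierStokesRegularity-19708) — task H5, step M4c (part 2): the weak equation of the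
# lifted solution (Fubini), DESCENT of the Liouville property, and the LIOUVILLE THEOREM IN EVERY DIMENSION

Seat ns-poloidal-K2-p3 g2 (`ledger fact claim` #1 on `Literature.Analysis.PDE.divFormLiouville`).

* `lift_weak` — if `u` is an entire `C¹` weak solution for `a` on `ℝⁿ`, then `ũ = u ∘ π` is one for `ã` on `ℝⁿ⁺¹`
  (Fubini over the last coordinate: each slice gives the `n`-dimensional weak equation with the test function `η_t`);
* `liouville_descent` — Liouville in dimension `n+1` (for all ellipticity constants) implies Liouville in dimension `n`;
* `liouville_all` — **every bounded entire `C¹` weak solution of `div(a∇u) = 0`, `a` measurable symmetric with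
  `λ|ξ|² ≤ ξ·aξ`, `|aᵢⱼ| ≤ Λ`, is constant, in every dimension `n`** — the statement of the named fact
  `Literature.Analysis.PDE.divFormLiouville` (its Literature-side discharge `divFormLiouville_holds` is a one-liner from here).

WHAT THIS IS NOT: nothing Navier–Stokes-specific; the NS consumer is the K2 lead's M11 (`…EllipticSlope`, p482138).
-/

noncomputable section

open MeasureTheory Set Function Filter Topology Metric Module
open scoped Matrix ENNReal NNReal

-- the summit and its single sub-problem share the name (CONVENTIONS §1), as in every Theorems file
set_option linter.dupNamespace false

namespace Summit.NavierStokesRegularity.NavierStokesRegularity.Theorems.PoloidalWindowDoorPoloidalWindowRigidityDivFormLiouvilleAll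

open Summit.NavierStokesRegularity.NavierStokesRegularity.Theorems.PoloidalWindowDoorPoloidalWindowRigidityDivFormCaccioppoli
open Summit.NavierStokesRegularity.NavierStokesRegularity.Theorems.PoloidalWindowDoorPoloidalWindowRigidityDivFormDescent
open Summit.NavierStokesRegularity.NavierStokesRegularity.Theorems.PoloidalWindowDoorPoloidalWindowRigidityDivFormLiouvilleHigh

variable {n : ℕ}

/-! ### The lifted weak equation -/

variable {a : EuclideanSpace ℝ (Fin n) → Matrix (Fin n) (Fin n) ℝ} {Λ : ℝ} {u : EuclideanSpace ℝ (Fin n) → ℝ}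

/-- **The lift `ũ = u ∘ π` is a weak solution for `ã`.** -/
theorem lift_weak (hmeas : ∀ i j, Measurable fun y => a y i j) (hbd : ∀ y i j, |a y i j| ≤ Λ)
    (hu : ContDiff ℝ 1 u)
    (hweak : ∀ η : EuclideanSpace ℝ (Fin n) → ℝ, ContDiff ℝ 1 η → HasCompactSupport η →
      ∫ y, ∑ i, ∑ j, a y i j * fderiv ℝ u y (EuclideanSpace.single i 1) *
        fderiv ℝ η y (EuclideanSpace.single j 1) = 0)
    (η : EuclideanSpace ℝ (Fin (n + 1)) → ℝ) (hη : ContDiff ℝ 1 η) (hηc : HasCompactSupport η) :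
    ∫ z, ∑ I, ∑ J, liftCoeff a z I J * fderiv ℝ (fun z => u (proj n z)) z (EuclideanSpace.single I 1) *
      fderiv ℝ η z (EuclideanSpace.single J 1) = 0 := by
  -- the slice integrand `G0 t x = Σ aᵢⱼ(x) ∂ᵢu(x) ∂ⱼη_t(x)`
  set e1 : EuclideanSpace ℝ (Fin (n + 1)) := EuclideanSpace.single (Fin.last n) (1 : ℝ) with he1
  set G0 : ℝ → EuclideanSpace ℝ (Fin n) → ℝ := fun t x => ∑ i, ∑ j, a x i j *
    fderiv ℝ u x (EuclideanSpace.single i 1) *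
      fderiv ℝ (fun x => η (emb n x + t • e1)) x (EuclideanSpace.single j 1) with hG0
  have hslice0 : ∀ t, ∫ x, G0 t x = 0 := fun t =>
    hweak _ (contDiff_slice hη t) (hasCompactSupport_slice hηc t)
  -- rewrite the lifted integrand as `G0 (z_last) (π z)`
  have hpt : ∀ z, ∑ I, ∑ J, liftCoeff a z I J * fderiv ℝ (fun z => u (proj n z)) z (EuclideanSpace.single I 1) *
      fderiv ℝ η z (EuclideanSpace.single J 1) = G0 (z (Fin.last n)) (proj n z) := fun z => by
    rw [lift_integrand_eq hu hη z]
  simp_rw [hpt]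
  -- integrability of `z ↦ G0 (z_last) (πz)` on `ℝⁿ⁺¹`: undo the rewrite and bound term by term
  have hInt : Integrable fun z : EuclideanSpace ℝ (Fin (n + 1)) => G0 (z (Fin.last n)) (proj n z) := by
    have heq : (fun z : EuclideanSpace ℝ (Fin (n + 1)) => G0 (z (Fin.last n)) (proj n z)) = fun z =>
        ∑ I, ∑ J, liftCoeff a z I J * fderiv ℝ (fun z => u (proj n z)) z (EuclideanSpace.single I 1) *
          fderiv ℝ η z (EuclideanSpace.single J 1) := by
      funext z; rw [hpt z]
    rw [heq]
    refine integrable_finsetSum _ fun I _ => integrable_finsetSum _ fun J _ => ?_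
    have hcu := continuous_fderiv_single (contDiff_lift (n := n) hu) I
    have hcη := continuous_fderiv_single hη J
    have h := integrable_mul_of_le_continuous (n := n + 1)
      (m := fun z => liftCoeff a z I J * fderiv ℝ (fun z => u (proj n z)) z (EuclideanSpace.single I 1))
      (M := fun z => max Λ 1 * |fderiv ℝ (fun z => u (proj n z)) z (EuclideanSpace.single I 1)|)
      (φ := fun z => fderiv ℝ η z (EuclideanSpace.single J 1))
      ((measurable_liftCoeff hmeas I J).mul hcu.measurable) (continuous_const.mul hcu.abs)
      (fun z => by rw [abs_mul]; exact mul_le_mul_of_nonneg_right (abs_liftCoeff_le hbd z I J) (abs_nonneg _))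
      hcη ?_
    · exact h
    · have h0 : HasCompactSupport (fderiv ℝ η) := hηc.fderiv (𝕜 := ℝ)
      exact h0.mono (Function.support_subset_iff'.2 fun z hz => by
        simp only [Function.mem_support, not_not] at hz; simp [hz])
  -- (1) to `Fin (n+1) → ℝ`
  set g : (Fin (n + 1) → ℝ) → ℝ := fun f => G0 (f (Fin.last n)) (WithLp.toLp 2 fun j => f (Fin.castSucc j)) with hg
  have hproj : ∀ z : EuclideanSpace ℝ (Fin (n + 1)), proj n z = WithLp.toLp 2 (fun j => z (Fin.castSucc j)) := fun z =>
    PiLp.ext fun j => by simp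
  have hGg : (fun z : EuclideanSpace ℝ (Fin (n + 1)) => G0 (z (Fin.last n)) (proj n z)) = g ∘ WithLp.ofLp := by
    funext z; simp only [Function.comp_apply, hg, hproj]
  have hmp1 : MeasurePreserving (MeasurableEquiv.toLp 2 (Fin (n + 1) → ℝ)).symm := by
    simpa [MeasurableEquiv.coe_toLp_symm] using PiLp.volume_preserving_ofLp (Fin (n + 1))
  have h1 : ∫ z : EuclideanSpace ℝ (Fin (n + 1)), G0 (z (Fin.last n)) (proj n z) = ∫ f : Fin (n + 1) → ℝ, g f := by
    rw [hGg]
    exact hmp1.integral_comp' g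
  have hIg : Integrable g := by
    have h := (hmp1.integrable_comp_emb (MeasurableEquiv.toLp 2 (Fin (n + 1) → ℝ)).symm.measurableEmbedding (g := g)).1
    apply h
    rw [MeasurableEquiv.coe_toLp_symm, ← hGg]
    exact hInt
  -- (2) split the last coordinate
  set e := MeasurableEquiv.piFinSuccAbove (fun _ : Fin (n + 1) => ℝ) (Fin.last n) with he
  have hmp2 : MeasurePreserving e.symm := (volume_preserving_piFinSuccAbove (fun _ : Fin (n + 1) => ℝ) (Fin.last n)).symm _
  have hge : ∀ p : ℝ × (Fin n → ℝ), g (e.symm p) = G0 p.1 (WithLp.toLp 2 p.2) := by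
    rintro ⟨t, x⟩
    simp only [hg, he, MeasurableEquiv.piFinSuccAbove, MeasurableEquiv.symm_mk, MeasurableEquiv.coe_mk,
      Equiv.symm_symm, Fin.insertNthEquiv, Equiv.coe_fn_mk, Fin.insertNth_last', Fin.snoc_last]
    congr 2
    funext j
    rw [Fin.snoc_castSucc]
  have h2 : ∫ f : Fin (n + 1) → ℝ, g f = ∫ p : ℝ × (Fin n → ℝ), G0 p.1 (WithLp.toLp 2 p.2) := by
    rw [← hmp2.integral_comp' g]
    exact integral_congr_ae (Eventually.of_forall hge)
  have hIp : Integrable fun p : ℝ × (Fin n → ℝ) => G0 p.1 (WithLp.toLp 2 p.2) := by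
    have h := (hmp2.integrable_comp_emb e.symm.measurableEmbedding (g := g)).2 hIg
    exact h.congr (Eventually.of_forall hge)
  -- (3) Fubini and the slices
  have hmp3 : MeasurePreserving (MeasurableEquiv.toLp 2 (Fin n → ℝ)) := by
    simpa [MeasurableEquiv.coe_toLp] using PiLp.volume_preserving_toLp (Fin n)
  have h3 : ∫ p : ℝ × (Fin n → ℝ), G0 p.1 (WithLp.toLp 2 p.2) = ∫ t : ℝ, ∫ x : Fin n → ℝ, G0 t (WithLp.toLp 2 x) := by
    rw [← integral_prod _ hIp]; rfl
  have h4 : ∀ t : ℝ, ∫ x : Fin n → ℝ, G0 t (WithLp.toLp 2 x) = 0 := by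
    intro t
    have h := hmp3.integral_comp' (G0 t)
    rw [MeasurableEquiv.coe_toLp] at h
    rw [h]
    exact hslice0 t
  rw [h1, h2, h3]
  simp_rw [h4]
  simp


/-! ### Descent of the Liouville property and the theorem in every dimension -/

/-- **Descent.**  If the Liouville theorem holds in dimension `n+1` (for all measurable symmetric uniformly elliptic
bounded coefficient fields and all ellipticity constants), it holds in dimension `n`: apply it to `ũ = u ∘ π`, `ã`. -/
theorem liouville_descent
    (hN : ∀ (a : EuclideanSpace ℝ (Fin (n + 1)) → Matrix (Fin (n + 1)) (Fin (n + 1)) ℝ) (lam Λ : ℝ), 0 < lam →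
      (∀ i j, Measurable fun y => a y i j) → (∀ y, (a y).IsSymm) →
      (∀ y (ξ : Fin (n + 1) → ℝ), lam * (ξ ⬝ᵥ ξ) ≤ ξ ⬝ᵥ (a y *ᵥ ξ)) → (∀ y i j, |a y i j| ≤ Λ) →
      ∀ (u : EuclideanSpace ℝ (Fin (n + 1)) → ℝ), ContDiff ℝ 1 u → (∃ K : ℝ, ∀ y, |u y| ≤ K) →
        (∀ η : EuclideanSpace ℝ (Fin (n + 1)) → ℝ, ContDiff ℝ 1 η → HasCompactSupport η →
          ∫ y, ∑ i, ∑ j, a y i j * fderiv ℝ u y (EuclideanSpace.single i 1) *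
            fderiv ℝ η y (EuclideanSpace.single j 1) = 0) →
        ∀ x y, u x = u y)
    (a : EuclideanSpace ℝ (Fin n) → Matrix (Fin n) (Fin n) ℝ) (lam Λ : ℝ) (hlam : 0 < lam)
    (hmeas : ∀ i j, Measurable fun y => a y i j) (hsymm : ∀ y, (a y).IsSymm)
    (hell : ∀ y (ξ : Fin n → ℝ), lam * (ξ ⬝ᵥ ξ) ≤ ξ ⬝ᵥ (a y *ᵥ ξ)) (hbd : ∀ y i j, |a y i j| ≤ Λ)
    (u : EuclideanSpace ℝ (Fin n) → ℝ) (hu : ContDiff ℝ 1 u) (hK : ∃ K : ℝ, ∀ y, |u y| ≤ K)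
    (hweak : ∀ η : EuclideanSpace ℝ (Fin n) → ℝ, ContDiff ℝ 1 η → HasCompactSupport η →
      ∫ y, ∑ i, ∑ j, a y i j * fderiv ℝ u y (EuclideanSpace.single i 1) *
        fderiv ℝ η y (EuclideanSpace.single j 1) = 0) (x y : EuclideanSpace ℝ (Fin n)) :
    u x = u y := by
  obtain ⟨K, hK⟩ := hK
  have h := hN (liftCoeff a) (min lam 1) (max Λ 1) (lt_min hlam one_pos) (measurable_liftCoeff hmeas)
    (isSymm_liftCoeff hsymm) (liftCoeff_elliptic hell) (abs_liftCoeff_le hbd) (fun z => u (proj n z))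
    (contDiff_lift hu) ⟨K, fun z => hK _⟩ (lift_weak hmeas hbd hu hweak) (emb n x) (emb n y)
  simpa using h

/-- **LIOUVILLE THEOREM for `div(a∇u) = 0` in every dimension** (De Giorgi–Nash–Moser; Moser 1961, corollary of Thm 1;
Jost, *PDE*, Thm 14.2.3): for `a` measurable, symmetric, `λ|ξ|² ≤ ξ·aξ` (`λ > 0`), `|aᵢⱼ| ≤ Λ`, every bounded
`u ∈ C¹(ℝⁿ)` with `∫ Σ aᵢⱼ ∂ᵢu ∂ⱼη = 0` for all `η ∈ C¹_c` is constant.  (`n ≥ 3`: Moser's Harnack inequality, M4b;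
`n ≤ 2`: descent from `n + 1`.) -/
theorem liouville_all (n : ℕ) (a : EuclideanSpace ℝ (Fin n) → Matrix (Fin n) (Fin n) ℝ) (lam Λ : ℝ)
    (hlam : 0 < lam) (hmeas : ∀ i j, Measurable fun y => a y i j) (hsymm : ∀ y, (a y).IsSymm)
    (hell : ∀ y (ξ : Fin n → ℝ), lam * (ξ ⬝ᵥ ξ) ≤ ξ ⬝ᵥ (a y *ᵥ ξ)) (hbd : ∀ y i j, |a y i j| ≤ Λ)
    (u : EuclideanSpace ℝ (Fin n) → ℝ) (hu : ContDiff ℝ 1 u) (hK : ∃ K : ℝ, ∀ y, |u y| ≤ K)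
    (hweak : ∀ η : EuclideanSpace ℝ (Fin n) → ℝ, ContDiff ℝ 1 η → HasCompactSupport η →
      ∫ y, ∑ i, ∑ j, a y i j * fderiv ℝ u y (EuclideanSpace.single i 1) *
        fderiv ℝ η y (EuclideanSpace.single j 1) = 0) (x y : EuclideanSpace ℝ (Fin n)) :
    u x = u y := by
  -- `P m`: the Liouville property in dimension `m`
  let P : ℕ → Prop := fun m => ∀ (a : EuclideanSpace ℝ (Fin m) → Matrix (Fin m) (Fin m) ℝ) (lam Λ : ℝ), 0 < lam →
      (∀ i j, Measurable fun y => a y i j) → (∀ y, (a y).IsSymm) →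
      (∀ y (ξ : Fin m → ℝ), lam * (ξ ⬝ᵥ ξ) ≤ ξ ⬝ᵥ (a y *ᵥ ξ)) → (∀ y i j, |a y i j| ≤ Λ) →
      ∀ (u : EuclideanSpace ℝ (Fin m) → ℝ), ContDiff ℝ 1 u → (∃ K : ℝ, ∀ y, |u y| ≤ K) →
        (∀ η : EuclideanSpace ℝ (Fin m) → ℝ, ContDiff ℝ 1 η → HasCompactSupport η →
          ∫ y, ∑ i, ∑ j, a y i j * fderiv ℝ u y (EuclideanSpace.single i 1) *
            fderiv ℝ η y (EuclideanSpace.single j 1) = 0) →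
        ∀ x y, u x = u y
  have hP : ∀ k m : ℕ, 3 ≤ m + k → P m := by
    intro k
    induction k with
    | zero => intro m hm; exact fun a lam Λ hlam hmeas hsymm hell hbd u hu hK hweak x y =>
        liouville_of_three_le (by omega) a lam Λ hlam hmeas hsymm hell hbd u hu hK hweak x y
    | succ k ih => intro m hm; exact fun a lam Λ hlam hmeas hsymm hell hbd u hu hK hweak x y =>
        liouville_descent (ih (m + 1) (by omega)) a lam Λ hlam hmeas hsymm hell hbd u hu hK hweak x y
  exact hP 3 n (by omega) a lam Λ hlam hmeas hsymm hell hbd u hu hK hweak x y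

/-- **Discharge of the named fact `Literature.Analysis.PDE.divFormLiouville`** (De Giorgi–Nash–Moser Liouville theorem;
Jost, *PDE*, Thm 14.2.3; Moser 1961, Thm 1 and corollary).  Proved in the tree by the chain
`…DivFormCaccioppoli` → `…CaccioppoliPowers` → `…LogBMO` → `…Crossover` → `…ReverseHolder` → `…MoserStep` → `…MoserChain`
→ `…Harnack` → `…LiouvilleHigh` → `…Descent` → this file (seat ns-poloidal-K2-p3 g2, `ledger fact claim` #1).
[cite: Jost2013PDE, Thm 14.2.3 (p. 370)] [cite: Moser1961Harnack, Thm 1] -/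
theorem _root_.Literature.Analysis.PDE.divFormLiouville_holds : Literature.Analysis.PDE.divFormLiouville :=
  fun n a lam Λ hlam hmeas hsymm hell hbd u hu hK hweak x y =>
    liouville_all n a lam Λ hlam hmeas hsymm hell hbd u hu hK hweak x y

end Summit.NavierStokesRegularity.NavierStokesRegularity.Theorems.PoloidalWindowDoorPoloidalWindowRigidityDivFormLiouvilleAll

end
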